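import Summits.BirchSwinnertonDyer.BirchSwinnertonDyer.Theorems.SemiOrdinaryEisensteinDescentShaTwoCochainIdeleDescent
import Literature.Algebra.Homology.CoinducedConjugation
import HarnessLib

/-!
# The Ш²-cochain bridge, step S3b (class side), first lemma: door-c6's transport `toAbsLayer` (`Γ_K ⧸ U_E`-layers → `Γ_K ⧸ Γ_E`-layers)
# commutes with the transitions of the two layer systems (Serre CG I §2.2 Prop. 8: the maps of the direct system are the inflations)

Route `SemiOrdinaryEisensteinDescent` (BSD, rung W-ALL row 2·3@3), Kolyvagin column, Cassels–Tate lane (print item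
`CasselsTateLevelInputsFact`, stmt-BirchSwinnertonDyer-20191).  Sequel of `…ShaTwoCochainIdeleDescent` (p640146) and
`…ShaTwoCochainIdeleInvariantSum` (S3, idèle side); see `Cruxes/WildKolyvaginUpperAtThree/S3-IDELE-DESCENT-w2g11.md` §3 for the
remaining class-side lemma (T-Cα) «`classInvAll K E (iso_E w)` depends only on `infTwo (toAbsLayer w) ∈ H²_cont(Γ_K, C̄)`», whose proof is:
`infTwo_eq_infTwo_iff_exists_layerInf_eq` (tree) → THIS FILE → injectivity of `toAbsLayer` on `Hⁿ` (not yet in the tree; its inverse on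
vectors should be built next to `LayerDelta.toAbsLayerHom` in `PresentationLayerTransport`, whose instance context elaborates it) →
`IdeleClassBar.map_invariantsStepIncl_comp_layerCohomologyIso` + `layerInf_eq_classInf` + `classInvAll_classInf` (tree).

* **`layerInf_toAbsLayer`** — for layers `E ≤ E'` and any `X : C_Γ`:
  `layerInf E E' (toAbsLayer E X n c) = toAbsLayer E' X n (Hⁿ(quotMap, invariantsStepIncl) c)` — door-c4's transition
  `Hⁿ(Γ_K ⧸ U_E, X^{U_E}) → Hⁿ(Γ_K ⧸ U_{E'}, X^{U_{E'}})` (`LayerColimit.stepG`) followed by `toAbsLayer E'` equals `toAbsLayer E` followed by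
  door-c6 g10's `layerInf E E'` (all four are `groupCohomology.map` along `[σ] ↦ [σ]` with the identity on vectors; Mathlib
  `groupCohomology.map_comp` and the tree's `map_congr'`).

THEOREMS ONLY (no definition, no instance, no instance attribute, no named fact, no `sorry`).  Bookkeeping; no case of BSD, of
Poitou–Tate or of Cassels–Tate is proved; BSD is not proved by any of this.  Width seat `bsd-wall-soed-p2-w2` g11;
`--supports stmt-BirchSwinnertonDyer-20480`, helper.  Route-free.

## References
* [SerreGaloisCohomology1997] J.-P. Serre, *Galois Cohomology* (1997), I §2.2 Proposition 8.
* [NeukirchSchmidtWingberg2008] J. Neukirch, A. Schmidt, K. Wingberg, *Cohomology of Number Fields* (2008), (1.5.1).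
-/
noncomputable section

set_option linter.dupNamespace false
set_option autoImplicit false

namespace Summit.BirchSwinnertonDyer.BirchSwinnertonDyer.Theorems.ShaTwoCochain

open CategoryTheory groupCohomology Field NumberField IsDedekindDomain
open Literature.NumberTheory.GaloisRepresentations Literature.NumberTheory.GaloisRepresentations.IdeleClassBar
open Literature.NumberTheory.GaloisRepresentations.DGMBridge Literature.NumberTheory.GaloisRepresentations.LayerDelta
open Literature.Algebra.Homology Literature.Algebra.Homology.DiscreteRep
open scoped ContRepresentation

variable {K : Type} [Field K] [NumberField K]

/-! ## §1 `toAbsLayer` commutes with the transitions of the two layer systems -/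

omit [NumberField K] in
/-- **Naturality of the transport `toAbsLayer` under enlarging the layer**: for layers `E ≤ E'`, door-c4's transition
`Hⁿ(Γ_K ⧸ U_E, X^{U_E}) → Hⁿ(Γ_K ⧸ U_{E'}, X^{U_{E'}})` followed by `toAbsLayer E'` is `toAbsLayer E` followed by door-c6's `layerInf E E'`
(all four maps are `groupCohomology.map` along `[σ] ↦ [σ]` with the identity on vectors). [cite: SerreGaloisCohomology1997, I §2.2 Proposition 8] -/
theorem layerInf_toAbsLayer (E E' : GalLayer K) [Normal K E.1] [Normal K E'.1] [FiniteDimensional K E.1] [FiniteDimensional K E'.1]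
    (h : E ≤ E') (X : DiscreteRepCat ℤ (absoluteGaloisGroup K)) (n : ℕ)
    (c : groupCohomology ((invariantsQuotFunctor ℤ (E.openNormalSubgroup : Subgroup (absoluteGaloisGroup K))).obj X) n) :
    layerInf K E.1 E'.1 (toDGM X) h n (toAbsLayer E X n c) =
      toAbsLayer E' X n (groupCohomology.map
        (quotMap (E.openNormalSubgroup : Subgroup (absoluteGaloisGroup K)) (E'.openNormalSubgroup : Subgroup (absoluteGaloisGroup K))
          (GalLayer.coe_openNormalSubgroup_le h))
        (invariantsStepIncl (E.openNormalSubgroup : Subgroup (absoluteGaloisGroup K))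
          (E'.openNormalSubgroup : Subgroup (absoluteGaloisGroup K)) (GalLayer.coe_openNormalSubgroup_le h) X) n c) := by
  have hfg : (quotEquivAbs E).toMonoidHom.comp (layerQuotientMap K E.1 E'.1 h) =
      (quotMap (E.openNormalSubgroup : Subgroup (absoluteGaloisGroup K)) (E'.openNormalSubgroup : Subgroup (absoluteGaloisGroup K))
          (GalLayer.coe_openNormalSubgroup_le h)).comp (quotEquivAbs E').toMonoidHom := by
    refine MonoidHom.ext fun q => ?_
    induction q using QuotientGroup.induction_on with
    | H σ => rfl
  have key : toAbsLayer E X n ≫ layerInf K E.1 E'.1 (toDGM X) h n =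
      groupCohomology.map
          (quotMap (E.openNormalSubgroup : Subgroup (absoluteGaloisGroup K)) (E'.openNormalSubgroup : Subgroup (absoluteGaloisGroup K))
            (GalLayer.coe_openNormalSubgroup_le h))
          (invariantsStepIncl (E.openNormalSubgroup : Subgroup (absoluteGaloisGroup K))
            (E'.openNormalSubgroup : Subgroup (absoluteGaloisGroup K)) (GalLayer.coe_openNormalSubgroup_le h) X) n ≫
        toAbsLayer E' X n := by
    dsimp only [toAbsLayer, Literature.NumberTheory.GaloisRepresentations.layerInf]
    rw [← groupCohomology.map_comp, ← groupCohomology.map_comp]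
    refine map_congr' (k := ℤ) hfg _ _ (fun x => ?_) n
    exact Subtype.ext rfl
  exact congrArg (fun φ => (ConcreteCategory.hom φ) c) key

end Summit.BirchSwinnertonDyer.BirchSwinnertonDyer.Theorems.ShaTwoCochain

end
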